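import Mathlib
import HarnessLib
import HarnessLib.Audit
import Summits.KontsevichZagierPeriods.Statement
import Literature.NumberTheory.Transcendental.KZExpCalculus
import Literature.NumberTheory.Transcendental.KZExpCCalculus
import HarnessLib.Audit.Status.Attr

/-!
Route: WickWedge

DORMANT since 2026-08-23T18:53:56Z (reconciler: no traction for 6.2 d (last activity item-evidence-added at 2026-08-17T14:17:59Z); parked, not closed — `ledger route dormant route-KontsevichZagierPeriods-WickWedge --off` to reactivate) — unstaffed, not closed; items shared with open routes are served there. `ledger route dormant <id> --off` reactivates.

# Route WickWedge — Bessel-moment relations are KZ-literal with Wick-only proofs; Wick rotation is a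
move only with COMPLEX exponential phases — complexify KZexp, test on the banana corpus, descend by
conservativity

X = KernelC ∧ ComplexDescent ("it suffices to show"): enlarge the H21 calculus not to the landed
REAL-weight exponential
calculus KZexp (∫_σ e^{−g} f, g real) but to the COMPLEX-PHASE one KZexpC of the literature's
exponential periods (∫_σ e^{−g−iθ} f,
f g θ ℚ-semialgebraic, absolutely convergent — CommelinHabeggerHuber2020 Def. 2 /
KontsevichZagierPeriods2001 §4.3), with the same
five moves; KernelC := every formal combination of such representations with value 0 is a
consequence of the moves, ComplexDescent :=
a ℤ-combination of CLASSICAL representations that is a KZexpC-relation is already a KZ relation. In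
KZexpC a Wick rotation of a
Schwinger-parametrised ray ∫₀^∞ e^{−s(1+im)S}A ds is ONE bounded Newton–Leibniz move in the slope m
plus ONE improper move in s
(∂ₘu = ∂ₛ[(is/(1+im))u]); the monodromy K₀(e^{iπ}t) = K₀(t) − iπI₀(t) is a one-parameter family of
absolutely convergent
complex-phase representations (contour 0 → −iα → −iα+∞ in ∫e^{−w cosh u}du), and with it the
Bessel-moment SUM RULES and QUADRATIC
RELATIONS (FresanSabbahYu2023 Thm 1, Cor 7; Zhou2017; Zhou2021) — honest integer-linear identities
among RATIONAL banana
representations R(a,b;c) of dimension a+b whose every known proof is such a rotation — become finite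
KZexpC chains, which
ComplexDescent turns into the KZ chains Conjecture 1 demands. Card realised:
bessel-moments-conservativity-wick-wedge (corpus +
"Wick = Stokes on a wedge"; corrected here: the wedge needs complex phases, the landed real KZexp
cannot express it). KZexpC LANDED
(rev 2–3, 2026-08-15: Literature/NumberTheory/Transcendental/KZExpCCalculus.lean — representations
[σ, f, g, θ], eval →+ ℂ, the five
moves with complex primitives Σ hᵢe^{−gᵢ−iθᵢ}, inclC : KZexp.FormalRep →+ KZexpC.FormalRep,
eval_inclC_incl, sandwich lemmas; NO Prop
registered), so X itself is typed: ComplexDescent (item 6842, crux) and KernelC (support,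
GPC-strength, not staked on) are decls of this
file and the deciding theorem `closes : ComplexDescent → KernelC → KontsevichZagierPeriods` is
proved. The real shadow
X_ℝ = KZexp.KernelConjecture ∧ KZexp.Conservative (items 0531/0530 of route ExpConservative) is NO
LONGER an item here (dropped rev 3:
open Literature Props in the cone; ComplexDescent ⟹ KZexp.Conservative by
`KZexpC.conservative_of_comap_inclC_incl_le`, and this route
still expects 0531 to FAIL exactly where X survives — crux SumRuleSixExp).
Lean: `ComplexDescent ∧ KernelC` i.e. `(∀ c : Literature.NumberTheory.Transcendental.KZ.FormalRep,
Literature.NumberTheory.Transcendental.KZexpC.inclC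
(Literature.NumberTheory.Transcendental.KZexp.incl c) ∈
Literature.NumberTheory.Transcendental.KZexpC.relations → c ∈
Literature.NumberTheory.Transcendental.KZ.relations) ∧ (∀ c :
Literature.NumberTheory.Transcendental.KZexpC.FormalRep,
Literature.NumberTheory.Transcendental.KZexpC.eval c = 0 → c ∈
Literature.NumberTheory.Transcendental.KZexpC.relations)`

## Assembly
ComplexDescent → KernelC → KontsevichZagierPeriods, PROVED as `theorem closes` (rev 3): given
rational r, r′ with equal values,
c = [r] − [r′] has KZ.eval c = 0, so inclC (incl c) has value ↑0 = 0 (`KZexpC.eval_inclC_incl`),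
KernelC makes it a KZexpC relation and
ComplexDescent makes c a KZ relation, i.e. KZ.Equivalent r r′ — the sandwich
`KZexpC.kzKernelConjecture_of_comap_le_of_ker_le` inlined so
that no open Literature Prop (KZKernelConjecture, KZexp.*) enters the cone. The corpus cruxes are
instances the summit predicts, not
premises: SumRuleSix ⇐ SumRuleSixC (KZexpC chain, support, typed rev 3) + TInsertion +
ComplexDescent; SumRuleSixExp ⇒ SumRuleSixC
(`KZexpC.inclC_mem_relations`); their refutation runs the other way (SumRuleSixKillSwitch).

Rationale: WHY THIS LINE. The Bessel moments IKM(a,b;c) = ∫₀^∞ I₀ᵃK₀ᵇtᶜdt are CLASSICAL periods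
(FresanSabbahYu2022: periods of M_k = H¹_mid(𝔾_m, SymᵏKl₂);
BlochKerrVanhove2015: banana Feynman integrals) with a two-line rational representation
π^a·IKM(a,b;c) = c!∫_{(0,∞)ᵃ×(1,∞)ᵇ} A/S^{c+1}
(s = tan θ/2, x = eᵘ; A = Π2/(1+sᵢ²)·Πxⱼ⁻¹, S = Σ(xⱼ+xⱼ⁻¹)/2 − Σ(1−sᵢ²)/(1+sᵢ²) ≥ b−a), yet for k =
a+b ≥ 5 every known proof of
the relations among them — FresanSabbahYu2023 Thm 1 (P·D⁻¹·ᵗP = (−2πi)^{k+1}B, irregular-Hodge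
period pairings) and Cor 7 ("closer
to the spirit of the Kontsevich–Zagier period conjecture … simply from the Stokes formula", Rem 8),
Zhou2017 (Hilbert transforms),
Zhou2018 (Wick rotations), Zhou2021 (Wrońskians), Broadhurst2016 (L-values) — continues a variable
into ℂ: in rules language, Stokes
with an OSCILLATORY weight e^{−iθ}. Checked this session: the k = 6 sum rule reads val R(3,3;1) =
3·val R(1,5;1) (two 6-dimensional
rational representations, coefficient 3, no π-representation), the k = 5 orthogonality entry
225(A₁C₃+A₃C₁) = 104A₁C₁ among
10-dimensional products — all to 1e−14 (folder num/). Imported: irregular Hodge theory / exponential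
motives (where these identities
live: FresanJossen2020 Thm 5.1.1 full faithfulness of classical inside exponential motives is the
motivic shadow of ComplexDescent,
Conj 8.2.6 that of KernelC), Feynman-integral analysis (Schwinger parametrisation = the t-insertion
move; Wick rotation = the wedge
move), o-minimality (CommelinHabeggerHuber2020 Thm 3: real parts of exponential periods are volumes
in ℝ_{sin,exp} — the sin|[0,1]
is exactly the phase the landed KZexp lacks). What no prior route has: an honest-period test family
on which the exponential detour
is OBSERVABLE (ExpConservative's tests are Γ-identities and Γ(1)=1), typed both classically
(SumRuleSix, QuinticOrthogonality ∈
KZ.relations?) and exponentially (SumRuleSixExp: does the REAL calculus of 0531 even reach it?),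
with a kill switch to ¬summit.

RANKED CRUXES. #2 SumRuleSix (crux) — the k = 6 Bessel sum rule π²∫₀^∞I₀³K₀³t dt = 3∫₀^∞I₀K₀⁵t dt
(FresanSabbahYu2023 Cor 7, j = 1; Zhou2017) as a KZ chain: [R(3,3;1)] − 3·[R(1,5;1)] ∈ KZ.relations
for the rational 6-dimensional banana representations (card items (3)/(5), made linear and π-free).
[difficulty: open-problem] (why it might fail: An instance of Conjecture 1 with no classical proof
known: Zhou2017 (Hilbert transform) and FresanSabbahYu2023 Cor 7 ((πi)^i monodromy phases,
rapid-decay Stokes) continue t into ℂ; a KZ chain must conjure π² out of two I₀↔K₀ swaps inside a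
rational 6-fold integral.) [FresanSabbahYu2023, Zhou2017, BaileyEtAl2008,
KontsevichZagierPeriods2001]
#3 SumRuleSixExp (crux) — the same identity between the EXPONENTIAL (Schwinger-parametrised) banana
representations E(3,3;1), E(1,5;1) — dimension 7, last coordinate t, integrand t·A, weight t·S — in
the landed real calculus: [E(3,3;1)] − 3·[E(1,5;1)] ∈ KZexp.relations. Sizes the calculus of
ExpConservative's crux 0531 on an honest identity (card item (2), linear version). [difficulty: XL]
(why it might fail: Every known proof rotates a contour (K₀(e^{iπ}t) = K₀(t) − iπI₀(t)); the
intermediate weights are complex, which real KZexp cannot express (cos(r·sin φ) is not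
semialgebraic), so a real five-move chain may not exist — a calculus-size failure of 0531.)
[Literature.NumberTheory.Transcendental.KZexp.improperNewtonLeibnizRel, FresanSabbahYu2023,
Zhou2017, CommelinHabeggerHuber2020]
#4 ComplexDescent (crux, item 6842, typed rev 3) — complex descent, the thesis conjunct: a
ℤ-combination of CLASSICAL representations that is a relation of the complex-phase calculus KZexpC
is already a KZ relation, ∀ c : KZ.FormalRep, inclC (incl c) ∈ KZexpC.relations → c ∈ KZ.relations
(elementwise form of `KZexpC.relations.comap (inclC.comp incl) ≤ KZ.relations`,
`KZexpC.comap_inclC_incl_le_iff`; the assembly's load-bearing open statement; implies the dropped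
real shadow KZexp.Conservative = ExpConservative 0530 by
`KZexpC.conservative_of_comap_inclC_incl_le`; sandwiched: KZKernelConjecture + soundness ⟹
ComplexDescent (`KZexpC.comap_inclC_incl_le_of_kzKernelConjecture`), ComplexDescent + KernelC ⟹
KZKernelConjecture). [difficulty: open-problem] (why it might fail: Stated nowhere in print (motivic
shadow only: FresanJossen2020 Thm 5.1.1); a complex Stokes chain between classical endpoints passes
through e^{−g−iθ}-weighted representations that no known retraction sends back to KZ moves (e^{−c},
e^{−iθ} ∉ ℚ̄); mod soundness false only together with KZKernelConjecture.)
[Literature.NumberTheory.Transcendental.KZexpC.comap_inclC_incl_le_iff,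
Literature.NumberTheory.Transcendental.KZexpC.comap_inclC_incl_le_of_kzKernelConjecture,
Literature.NumberTheory.Transcendental.KZexpC.conservative_of_comap_inclC_incl_le, FresanJossen2020,
KontsevichZagierPeriods2001, CommelinHabeggerHuber2020]
#5 QuinticOrthogonality (crux) — the (1,2) entry of the k = 5 quadratic relation P₅D₅⁻¹ᵗP₅ =
(−2πi)⁶B₅ (FresanSabbahYu2023 Thm 1 with Ex. 2: D₅ = [[0,8/15],[8/15,208/3375]], B₅ =
diag(−1/150,−1/40)): 225·(A₁C₃ + A₃C₁) = 104·A₁C₁, A_c = IKM(1,4;c), C_c = IKM(2,3;c), as a KZ chain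
among three 10-dimensional products R(1,4;·)×R(2,3;·) (card item (3): the first honest quadratic
instance, π-free). [difficulty: open-problem] (why it might fail: Only proofs: FresanSabbahYu2023
Thm 1 (irregular-Hodge period pairing on Sym⁵Kl₂) and Zhou2021 (Bessel Wrońskians), both
complex-analytic; a KZ chain must also handle products (KZProduct ideal moves) in L-value territory
(Broadhurst2016, level-15 form) — no classical mechanism known.) [FresanSabbahYu2023, Zhou2021,
Broadhurst2016, BlochKerrVanhove2015]
#9 KernelC (support, NEW rev 3) — the complex exponential kernel conjecture for the five KZexpC
moves: every formal ℤ-combination of complex-phase representations with value 0 is a relation, ∀ c :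
KZexpC.FormalRep, KZexpC.eval c = 0 → c ∈ KZexpC.relations (elementwise form of `KZexpC.eval.ker ≤
KZexpC.relations`, `KZexpC.ker_le_relations_iff`; posed KontsevichZagierPeriods2001 §4.3,
'Conjecture 1 … extended in an appropriate way to exponential periods'; GPC-strength, motivic shadow
FresanJossen2020 Conj 8.2.6). Load-bearing in `closes` but NOT staked on (support, exactly as
ExpKernelShadow 0293/0531 was): the route's falsifiable content is ComplexDescent + the corpus; it
replaces the dropped real shadow KZexp.KernelConjecture (with real conservativity
`KZexpC.kernelConjecture_of_comap_le_of_ker_le` gives it back). Why it might fail: calculus size (no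
product/Fubini move, one-representation boundary terms; this tree's reading of 'appropriate way').
[difficulty: open-problem] [Literature.NumberTheory.Transcendental.KZexpC.ker_le_relations_iff,
Literature.NumberTheory.Transcendental.KZexpC.kernelConjecture_of_comap_le_of_ker_le,
KontsevichZagierPeriods2001, FresanJossen2020]
#9 TInsertion (support) — Schwinger/Laplace t-insertion is one improper Newton–Leibniz move (3b): if
r.integrand = c!·A/S^{c+1} on r.domain with A, S ℚ-semialgebraic there, C¹ on an open neighbourhood,
S > 0, and e is the representation on r.domain × [0,∞) (t last) with integrand A·tᶜ and weight t·S,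
then e ~ ofKZ r in KZexp (primitive −Σ_{m≤c}(c!/m!)tᵐS^{m−c−1}A·e^{−tS} → 0). Links SumRuleSix and
SumRuleSixExp (incl-image), calibrates (3b). [difficulty: M]
[Literature.NumberTheory.Transcendental.KZexp.improperNewtonLeibnizRel, KontsevichZagierPeriods2001]
#9 SunriseThreshold (crux since retriage 2026-08-15; why it might fail: classical evaluations
integrate the fibres of A/S² to arctan/arccos primitives, outside rule 3 — barrier
KZ.noSemialgebraicPrimitive_inv_sub_two; π² must appear from two rational fibres) — k = 3
calibration (classical world): ∫₀^∞I₀K₀²t dt = π/(3√3) (sunrise at threshold: angle π/3 of the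
equilateral triangle; BaileyEtAl2008), i.e. the rational 3-dimensional representation R(1,2;1)
(value π²/(3√3)) is KZ-equivalent to the constant √3/9 on a product of two unit discs; the FSY k = 3
quadratic relation 27·R(1,2;1)² = π⁴ is its square. A prover who closes it records HOW the arccos
primitive is avoided (keep the angle as a dimension). [difficulty: L] [BaileyEtAl2008,
FresanSabbahYu2023, KontsevichZagierPeriods2001]
#9 SumRuleSixKillSwitch (support) — with the value identity val R(3,3;1) = 3·val R(1,5;1) as
hypothesis (FresanSabbahYu2023 Cor 7 / Zhou2017; cite-fact request filed), a proof that [R(3,3;1)] −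
3[R(1,5;1)] is NOT a KZ relation refutes the summit (kernel form ⟺ summit,
kzKernelConjecture_iff_isRational). Proved in the folder Sketch.lean (5 lines). [difficulty:
provable-now] [Literature.NumberTheory.Transcendental.kzKernelConjecture_iff_isRational,
FresanSabbahYu2023, Zhou2017]
#9 SumRuleSixC (support, item 6854, typed rev 3) — engine demonstration: the k = 6 sum rule between
the Schwinger representations of SumRuleSixExp, pushed into KZexpC, IS a complex relation: inclC
([E(3,3;1)] − 3·[E(1,5;1)]) ∈ KZexpC.relations. Transcription of FresanSabbahYu2023 Cor 7 / Zhou2017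
into moves: monodromy family K₀(te^{iα}), α ∈ [0, π], as absolutely convergent complex-phase
representations (c = cos φ, ξ = e^v semialgebraic data), constancy in α = one bounded Newton–Leibniz
move in α (flat transport), the ray pieces = improper moves (3b) with complex primitives.
SumRuleSixExp ⟹ SumRuleSixC (`KZexpC.inclC_mem_relations`); SumRuleSixC + TInsertion +
ComplexDescent ⟹ SumRuleSix. [difficulty: XL] [FresanSabbahYu2023, Zhou2017,
Literature.NumberTheory.Transcendental.KZexpC.improperNewtonLeibnizRel,
Literature.NumberTheory.Transcendental.KZexpC.newtonLeibnizRel]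

TWO-LAYER PLAN. Foreseen glued splits (k ≤ 2, depth 1), filed only when something closes or the
definition lands:
SumRuleSix ⇐ SumRuleSixC (the k = 6 sum rule as a KZexpC chain: monodromy family α ∈ [0,π] by flat
transport in α + Cauchy on the
upper half-plane as two Newton–Leibniz moves; informal support now) → ComplexDescent → SumRuleSix
(glue = descent applied to this c);
QuinticOrthogonality ⇐ QuinticC (FSY's period-pairing identity as Stokes on the product 𝔾_m × 𝔾_m
with complex phases, cf. card
integrate-over-the-cycle T2) → ComplexDescent → QuinticOrthogonality; ComplexDescent ⇐
ConservativeCR (KZexpC.relations.comap inclC ≤ KZexp.relations, `KZexpC.comap_inclC_le_iff`) →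
ExpConservative's 0530 → ComplexDescent
(`KZexpC.comap_inclC_incl_le_of_comap_inclC_le`: descend in two steps), filed only if 0530 moves;
the Laplace-layer retraction
[σ×ℝ₊, Σf_c tᶜ, t·S] ↦ c!/S^{c+1} stays a child of 0530 (route ExpConservative). Target re-base DONE
(rev 3): closes : ComplexDescent → KernelC → summit.

KILL CRITERIA. SumRuleSix REFUTED (an additive invariant of the four KZ move sets separating
[R(3,3;1)] from 3[R(1,5;1)]) ⇒ with the cited value
identity, SumRuleSixKillSwitch gives ¬KontsevichZagierPeriods: close `refuted:SumRuleSix`, hand the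
witness to route Neg — the summit
itself falls. QuinticOrthogonality refuted: same. SumRuleSixExp refuted ⇒ 0531 (real exponential
kernel conjecture) is refuted for a
calculus-size reason: ExpConservative's target dies, THIS route pivots to X = KernelC ∧
ComplexDescent as planned (not a close).
ComplexDescent REFUTED ⇒ granted soundness of the five complex moves (KZExpCCalculusProofs) the
witness c has KZ.eval c = 0 and c ∉ KZ.relations,
i.e. ¬KZKernelConjecture = ¬summit in kernel form
(`KZexpC.comap_inclC_incl_le_of_kzKernelConjecture`, contrapositive): close
`refuted:ComplexDescent`, hand the witness to route Neg — unless it is a (3b) limit-hypothesis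
artefact repairable by restating over bounded fibres.
ExpConservative's 0530 (KZexp.Conservative) refuted elsewhere ⇒ ComplexDescent refuted too (it
implies 0530). KernelC refuted by a
non-classical witness ⇒ restate KernelC over the classical image (support swap), the line survives.
KZKernelConjecture proved elsewhere moots everything;
a classical proof of SumRuleSix found in print demotes it to support (route survives on
QuinticOrthogonality / k ≥ 7).

NOT DECOMPOSED YET. (rev 3: KZexpC landed; ComplexDescent, KernelC, SumRuleSixC are TYPED items; the
real-shadow items ExpConservativity 0292 /
ExpKernelShadow 0293 were dropped from this route — they remain ExpConservative's 0530/0531.) The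
WickWedge engine lemma (rotation of a
Schwinger ray by |angle| < π/2 is 2 NL moves + 1 CoV in KZexpC) is not an item (provers attach it
with --supports SumRuleSixC);
the general sum-rule family Σᵢ(−1)ⁱC(k/2,2i+1)·R(2i+1,k−2i−1;c) = 0 (k ≡ 2 mod 4, c = 2j−1, j ≤
(k−2)/4; checked for k = 6, 10) and the
full FSY matrices for k ≥ 7 are not itemised (one instance per mechanism: linear k = 6, quadratic k
= 5); regularised moments
(FSY Def 4) are excluded on purpose (not absolutely convergent); the Laplace-layer retraction is a
child of 0530, later.

CHEAPEST FALSIFIER. (i) Normalisation check of the typed instances — DONE (pure-python tanh-sinh,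
folder num/): k=5 (Q11) 260A₁²−1125A₁A₃ = 2π⁴,
(Q22) 450C₁C₃−104C₁² = 3π², (Q12) 225(A₁C₃+A₃C₁) = 104A₁C₁; k=6 π²IKM(3,3;1) = 3IKM(1,5;1); k=10
(c=1,3); k=3 IKM(1,2;1) = π/(3√3);
k=4 IKM(1,3;1) = π²/16, IKM(0,4;1) = 7ζ(3)/8 — residuals ≤ 3e−12. (ii) The thesis' necessity claim
dies cheaply if a refuter
exhibits a REAL-variable proof of the k = 6 sum rule (e.g. Mellin–Barnes with real Γ-integrals
only): then SumRuleSixExp is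
plausibly provable and "complexify" is a convenience, not a necessity (the corpus items stand).
(iii) Lookup: does any source state a
rules-level / classical-period proof of a k ≥ 5 Bessel relation? Searched (zbMATH, Crossref; local
index down): none — FSY Rem 8
is the only rules-flavoured sentence, and it is about Stokes for rapid-decay (exponential) chains.

NUMBERS. FresanSabbahYu2023 Thm 1 / Ex. 2 (k = 5): D₅ = [[0, 8/15], [8/15, 2⁴·13/(3³·5³)]], D₅⁻¹ =
[[−13/60, 15/8], [15/8, 0]],
B₅ = [[−1/150, 0], [0, −1/40]], (−2πi)⁶ = −64π⁶; IKM(1,4;1) = 1.0712850554218, IKM(1,4;3) =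
0.0859372906918,
IKM(2,3;1) = 0.6603448690187, IKM(2,3;3) = 0.2522539448978; IKM(3,3;1) = 0.7645656350501, IKM(1,5;1)
= 2.5153201188707
(π²·0.76456… = 7.54596… = 3·2.51532…); IKM(1,2;1) = 0.6045997880781 = π/(3√3); IKM(1,3;1) =
0.6168502750681 = π²/16.
Sum rules (FresanSabbahYu2023 Cor 7, normalisation IKM_k(i,j) =
(−1)^{k−i}2^{k−j}(πi)^i∫I₀^iK₀^{k−i}t^j): k ≡ 2 mod 4,
Σᵢ C(k/2,2i+1)·IKM_k(2i+1,2j−1) = 0. Items at open: 9 (4 cruxes, 4 support, 1 assembly) + 2 informal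
+ 1 definition + 1 cite fact. Items at rev 3: 10 typed — 5 cruxes (SumRuleSix 2,
SumRuleSixExp 3, ComplexDescent, QuinticOrthogonality 5, SunriseThreshold), 4 support (KernelC,
TInsertion, SumRuleSixKillSwitch, SumRuleSixC), 1 assembly — + theorem closes.

DEFINITION REQUESTS. KZexpC — LANDED 2026-08-15 as
Literature/NumberTheory/Transcendental/KZExpCCalculus.lean (+ KZExpCCalculusProofs.lean: soundness
KZexpC.relations ≤ eval.ker); no Prop registered, the open statements are this route's items. As
requested: representations [σ, f, g, θ] (σ ⊆ ℝⁿ ℚ-semialgebraic;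
f, g, θ ℚ-semialgebraic on σ; e^{−g}|f| integrable on σ), value ∫_σ e^{−g(x)−iθ(x)} f(x) dx ∈ ℂ;
FormalRep, eval : →+ ℂ; the five
KZexp moves verbatim with complex primitives Σ hᵢe^{−gᵢ−iθᵢ} (hᵢ complex-valued via two real
semialgebraic functions), improper NL
with Tendsto → 0; inclC : KZexp.FormalRep →+ FormalRepC (θ := 0) injective, eval- and
move-compatible; open statements KernelC,
ConservativeC := ∀ c : KZ.FormalRep, inclC (incl c) ∈ relationsC → c ∈ KZ.relations, and the
sandwich lemmas mirroring
KZExpCalculus; sources KontsevichZagierPeriods2001 §4.3, CommelinHabeggerHuber2020 Def 2 (f complex,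
|Im f| bounded on G).
Cite fact: FresanSabbahYu2023 Cor 7 (k = 6, j = 1) = Zhou2017: π²∫₀^∞I₀³K₀³t dt = 3∫₀^∞I₀K₀⁵t dt
(hypothesis of the kill switch).

Novelty: Searches (2026-08-15; local searchd down — ConnectionReset; OpenAlex/arXiv 429): `lit search
--source crossref "Bessel moments sum
rules Hilbert transform Zhou"` (8; Zhou2017), `--source zbmath "Bessel moments quadratic relations"`
(3: FresanSabbahYu2023, Zhou2021
arXiv:2012.03523, Chuang–Yu 2024 doi:10.1007/s11139-024-00936-0), `--source zbmath "exponential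
periods Kontsevich-Zagier
conjecture"` (1: Kirby 2013), `--source zbmath "Wick rotation Feynman integral Bessel moments"` (0),
`--source crossref "Kontsevich
Zagier exponential periods o-minimal Commelin Habegger Huber"` (8: HuberMullerStach2017 ch.12,
CressonViusos2022, ViuSos 2020, Zhou
Ramanujan J 2016 "Kontsevich–Zagier integrals" = KZ-style representations evaluated analytically, no
rules), `lit galaxy search
"Bessel moments quadratic relations" --star all` (0 rows; crabby failed, queue saturated), `lit
frontier KontsevichZagierPeriods
--since 2020` (30 rows, none on Bessel / exponential rules), `lit read arxiv:2006.02702` (pp. 4, 12,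
17, 21 read: Thm 1, Ex. 2,
§5.2 normalisation, Cor 7/Rem 8), `lit read arxiv:2007.08280` (p. 3: Def 2, Thm 3), tree:
KZExpCalculus.lean design notes D1–D6
(real weights; CHH conventions "not reconciled"), all ten Theses files of the sub (ExpConservative's
tests are Γ-identities),
`ledger negatives` (empty).
Nearest prior art found: FresanSabbahYu2023 (arXiv:2006.02702) Thm 1 / Cor 7 / Rem 8 — the
identities and the one sentence relating
the Stokes proof to the spirit of the period conje  [refs: 10.1007/s11139-024-00936-0, 2012.03523, 2006.02702, 2007.08280, doi:10.1007/s11139-024-00936-0, arxiv:2006.02702, arxiv:2007.08280, Zhou2017, FresanSabbahYu2023, Zhou2021, HuberMullerStach2017, CressonViusos2022, Zhou2018, CommelinHabeggerHuber2020]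

Barriers (technique_class: complex-exp-widening wick-wedge conservativity-test): - technique_class: complex-exp-widening wick-wedge conservativity-test
- Literature.Barriers.KontsevichZagierPeriods.noSemialgebraicPrimitive_inv_sub_two: evaded by
construction — no move of this line takes a primitive OF an integrand: t-insertion uses the explicit
admissible primitive −Σ(c!/m!)tᵐS^{m−c−1}A·e^{−tS}, the wedge uses the integrand itself in the slope
direction (flat transport) and (is/(1+im))·u radially; SunriseThreshold is told to keep the angle as
a dimension rather than integrate to arccos.
- Literature.Barriers.KontsevichZagierPeriods.kzConjecture_implies_oddZetaAlgIndep: applies only to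
the kernel-type statements (ExpKernelShadow = 0531, the future KernelC), carried there exactly as in
ExpConservative; SumRuleSix / QuinticOrthogonality / SumRuleSixExp assert ONE known identity each
(no transcendence content), ExpConservativity / ComplexDescent assert nothing numerical (syntactic
statements about two calculi).
- Literature.Barriers.KontsevichZagierPeriods.kzConjecture_implies_twoPiI_log_algIndep: same —
confined to 0531 / KernelC; note the corpus is where 2πi enters honestly (monodromy phases (πi)^i),
as VALUES of rational representations, not as an independence claim.
- Literature.Barriers.KontsevichZagierPeriods.kzConjecture_implies_ellipticPeriods_algIndep: same;
the k = 3, 4 calibrations are CM / ζ(3) fibres consistent with it (FresanSabbahYu2023 Rem 10).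
- Literature.Barriers.KontsevichZagierPeriods.cressonViuSos_prop_3_2: not applicable — no single glo

History (route lifecycle, newest last):
- 2026-08-15T16:18:11Z · rev 3: restated Assembly (stmt-KontsevichZagierPeriods-5659) — route-repair gen2 step 3/3 (rbadge-…-26d3d325-g2): RE-ROUTE AROUND the two unproved cone facts KZexp.Conservative / KZexp.KernelConjecture ([status: open] conje (planner-rbadge-KontsevichZagierPeriods-WickWed-26d3d325-g2-0)
- 2026-08-15T16:18:11Z · rev 3: dropped stmt-KontsevichZagierPeriods-0292, stmt-KontsevichZagierPeriods-0293 — route-repair gen2 step 3/3 (rbadge-…-26d3d325-g2): RE-ROUTE AROUND the two unproved cone facts KZexp.Conservative / KZexp.KernelConjecture ([status: open] conje (planner-rbadge-KontsevichZagierPeriods-WickWed-26d3d325-g2-0)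
- 2026-08-15T16:21:08Z · rev 5: dropped stmt-KontsevichZagierPeriods-0293 — route-repair gen2 step 3b: drop ExpKernelShadow (0293 = KZexp.KernelConjecture, real-shadow Prop) again — the rev-3 edit reported it dropped but its wanted_by e (planner-rbadge-KontsevichZagierPeriods-WickWed-26d3d325-g2-0)
- 2026-08-16T02:18:04Z · AUTO-CRUX: 1 conjecture-grade item(s) promoted to crux (KernelC) — refuter vetting / tiering apply (operator:999:1362873)
- 2026-08-23T18:53:56Z · DORMANT — reconciler: no traction for 6.2 d (last activity item-evidence-added at 2026-08-17T14:17:59Z); parked, not closed — `ledger route dormant route-KontsevichZagier (operator:999:208202)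

sub-problem: KontsevichZagierPeriods · status: dormant · opened planner-plancard-KontsevichZagierPeriods-Kont-979e9fb8-0 2026-08-15T11:42:01Z · rev 5 · ledger route-KontsevichZagierPeriods-WickWedge
GENERATED by the gate from the ledger (D-0016/17). Provers cite these decls: `theorem foo : Summit.KontsevichZagierPeriods.KontsevichZagierPeriods.Theses.WickWedge.<Decl> := …` in Summits/KontsevichZagierPeriods/KontsevichZagierPeriods/Theorems/<Name>.lean.
-/

namespace Summit.KontsevichZagierPeriods.KontsevichZagierPeriods.Theses.WickWedge

open scoped BigOperators Topology Manifold Classical MeasureTheory ProbabilityTheory Matrix InnerProductSpace ComplexConjugate ContinuousMap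
open Filter Set Function TopologicalSpace MeasureTheory

attribute [summit_statement] _root_.KontsevichZagierPeriods

open Literature Periods

/-- item stmt-KontsevichZagierPeriods-5653 · crux · rank 2 · open · by planner
why it might fail: An instance of Conjecture 1 with no classical proof known: Zhou2017 (Hilbert transform) and FresanSabbahYu2023 Cor 7 ((πi)^i monodromy phases, rapid-decay Stokes) continue t into ℂ; a KZ chain must conjure π² out of two I₀↔K₀ swaps inside a rational 6-fold integral.
sources: FresanSabbahYu2023, Zhou2017, BaileyEtAl2008, KontsevichZagierPeriods2001
[crux] the k = 6 Bessel sum rule π²∫₀^∞I₀³K₀³t dt = 3∫₀^∞I₀K₀⁵t dt (FresanSabbahYu2023 Cor 7, j = 1;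
Zhou2017) as a KZ chain: [R(3,3;1)] − 3·[R(1,5;1)] ∈ KZ.relations for the rational 6-dimensional
banana representations (card items (3)/(5), made linear and π-free). [difficulty: open-problem] -/
@[route_item "route-KontsevichZagierPeriods-WickWedge"]
def SumRuleSix : Prop :=
  ∀ (r₃ r₁ : Literature.NumberTheory.Transcendental.KZ.IntegralRep 6), r₃.domain = {x | 0 < x 0 ∧ 0 < x 1 ∧ 0 < x 2 ∧ 1 < x 3 ∧ 1 < x 4 ∧ 1 < x 5} → Set.EqOn r₃.integrand (fun x => (2 / (1 + x 0 ^ 2)) * (2 / (1 + x 1 ^ 2)) * (2 / (1 + x 2 ^ 2)) * (x 3)⁻¹ * (x 4)⁻¹ * (x 5)⁻¹ / ((x 3 + (x 3)⁻¹) / 2 + (x 4 + (x 4)⁻¹) / 2 + (x 5 + (x 5)⁻¹) / 2 - (1 - x 0 ^ 2) / (1 + x 0 ^ 2) - (1 - x 1 ^ 2) / (1 + x 1 ^ 2) - (1 - x 2 ^ 2) / (1 + x 2 ^ 2)) ^ 2) r₃.domain → r₁.domain = {x | 0 < x 0 ∧ 1 < x 1 ∧ 1 < x 2 ∧ 1 <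 x 3 ∧ 1 < x 4 ∧ 1 < x 5} → Set.EqOn r₁.integrand (fun x => (2 / (1 + x 0 ^ 2)) * (x 1)⁻¹ * (x 2)⁻¹ * (x 3)⁻¹ * (x 4)⁻¹ * (x 5)⁻¹ / ((x 1 + (x 1)⁻¹) / 2 + (x 2 + (x 2)⁻¹) / 2 + (x 3 + (x 3)⁻¹) / 2 + (x 4 + (x 4)⁻¹) / 2 + (x 5 + (x 5)⁻¹) / 2 - (1 - x 0 ^ 2) / (1 + x 0 ^ 2)) ^ 2) r₁.domain → Literature.NumberTheory.Transcendental.KZ.of r₃ - 3 • Literature.NumberTheory.Transcendental.KZ.of r₁ ∈ Literature.NumberTheory.Transcendental.KZ.relations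

/-- item stmt-KontsevichZagierPeriods-5654 · crux · rank 3 · open · by planner
why it might fail: Every known proof rotates a contour (K₀(e^{iπ}t) = K₀(t) − iπI₀(t)); the intermediate weights are complex, which real KZexp cannot express (cos(r·sin φ) is not semialgebraic), so a real five-move chain may not exist — a calculus-size failure of 0531.
sources: Literature.NumberTheory.Transcendental.KZexp.improperNewtonLeibnizRel, FresanSabbahYu2023, Zhou2017, CommelinHabeggerHuber2020
[crux] the same identity between the EXPONENTIAL (Schwinger-parametrised) banana representations
E(3,3;1), E(1,5;1) — dimension 7, last coordinate t, integrand t·A, weight t·S — in the landed real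
calculus: [E(3,3;1)] − 3·[E(1,5;1)] ∈ KZexp.relations. Sizes the calculus of ExpConservative's crux
0531 on an honest identity (card item (2), linear version). [difficulty: XL] -/
@[route_item "route-KontsevichZagierPeriods-WickWedge"]
def SumRuleSixExp : Prop :=
  ∀ (e₃ e₁ : Literature.NumberTheory.Transcendental.KZexp.IntegralRep 7), e₃.domain = {z | 0 < z 0 ∧ 0 < z 1 ∧ 0 < z 2 ∧ 1 < z 3 ∧ 1 < z 4 ∧ 1 < z 5 ∧ 0 ≤ z 6} → Set.EqOn e₃.integrand (fun z => z 6 * ((2 / (1 + z 0 ^ 2)) * (2 / (1 + z 1 ^ 2)) * (2 / (1 + z 2 ^ 2)) * (z 3)⁻¹ * (z 4)⁻¹ * (z 5)⁻¹)) e₃.domain → Set.EqOn e₃.weight (fun z => z 6 * ((z 3 + (z 3)⁻¹) / 2 + (z 4 + (z 4)⁻¹) / 2 + (z 5 + (z 5)⁻¹) / 2 - (1 - z 0 ^ 2) / (1 + z 0 ^ 2) - (1 - z 1 ^ 2) / (1 + z 1 ^ 2) - (1 - z 2 ^ 2) / (1 + z 2 ^ 2))) e₃.domain → e₁.domain = {z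 | 0 < z 0 ∧ 1 < z 1 ∧ 1 < z 2 ∧ 1 < z 3 ∧ 1 < z 4 ∧ 1 < z 5 ∧ 0 ≤ z 6} → Set.EqOn e₁.integrand (fun z => z 6 * ((2 / (1 + z 0 ^ 2)) * (z 1)⁻¹ * (z 2)⁻¹ * (z 3)⁻¹ * (z 4)⁻¹ * (z 5)⁻¹)) e₁.domain → Set.EqOn e₁.weight (fun z => z 6 * ((z 1 + (z 1)⁻¹) / 2 + (z 2 + (z 2)⁻¹) / 2 + (z 3 + (z 3)⁻¹) / 2 + (z 4 + (z 4)⁻¹) / 2 + (z 5 + (z 5)⁻¹) / 2 - (1 - z 0 ^ 2) / (1 + z 0 ^ 2))) e₁.domain → Literature.NumberTheory.Transcendental.KZexp.of e₃ - 3 • Literature.NumberTheory.Transcendental.KZexp.of e₁ ∈ Literature.NumberTheory.Transcendental.KZexp.relations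

/-- item stmt-KontsevichZagierPeriods-5655 · crux · rank 5 · open · by planner
why it might fail: Only proofs: FresanSabbahYu2023 Thm 1 (irregular-Hodge period pairing on Sym⁵Kl₂) and Zhou2021 (Bessel Wrońskians), both complex-analytic; a KZ chain must also handle products (KZProduct ideal moves) in L-value territory (Broadhurst2016, level-15 form) — no classical mechanism known.
sources: FresanSabbahYu2023, Zhou2021, Broadhurst2016, BlochKerrVanhove2015
[crux] the (1,2) entry of the k = 5 quadratic relation P₅D₅⁻¹ᵗP₅ = (−2πi)⁶B₅ (FresanSabbahYu2023 Thm
1 with Ex. 2: D₅ = [[0,8/15],[8/15,208/3375]], B₅ = diag(−1/150,−1/40)): 225·(A₁C₃ + A₃C₁) =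
104·A₁C₁, A_c = IKM(1,4;c), C_c = IKM(2,3;c), as a KZ chain among three 10-dimensional products
R(1,4;·)×R(2,3;·) (card item (3): the first honest quadratic instance, π-free). [difficulty:
open-problem] -/
@[route_item "route-KontsevichZagierPeriods-WickWedge"]
def QuinticOrthogonality : Prop :=
  ∀ (F G : ℕ → (Fin 5 → ℝ) → ℝ), (∀ (c : ℕ) (x : Fin 5 → ℝ), F c x = (c.factorial : ℝ) * ((2 / (1 + x 0 ^ 2)) * (x 1)⁻¹ * (x 2)⁻¹ * (x 3)⁻¹ * (x 4)⁻¹) / ((x 1 + (x 1)⁻¹) / 2 + (x 2 + (x 2)⁻¹) / 2 + (x 3 + (x 3)⁻¹) / 2 + (x 4 + (x 4)⁻¹) / 2 - (1 - x 0 ^ 2) / (1 + x 0 ^ 2)) ^ (c + 1)) → (∀ (c : ℕ) (x : Fin 5 → ℝ), G c x = (c.factorial : ℝ) * ((2 / (1 + x 0 ^ 2)) * (2 / (1 + x 1 ^ 2)) * (x 2)⁻¹ * (x 3)⁻¹ * (x 4)⁻¹) / ((x 2 + (x 2)⁻¹) / 2 + (x 3 + (x 3)⁻¹) / 2 + (x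 4 + (x 4)⁻¹) / 2 - (1 - x 0 ^ 2) / (1 + x 0 ^ 2) - (1 - x 1 ^ 2) / (1 + x 1 ^ 2)) ^ (c + 1)) → ∀ (p q s : Literature.NumberTheory.Transcendental.KZ.IntegralRep 10), p.domain = {z | 0 < z 0 ∧ 1 < z 1 ∧ 1 < z 2 ∧ 1 < z 3 ∧ 1 < z 4 ∧ 0 < z 5 ∧ 0 < z 6 ∧ 1 < z 7 ∧ 1 < z 8 ∧ 1 < z 9} → q.domain = p.domain → s.domain = p.domain → Set.EqOn p.integrand (fun z => F 1 ![z 0, z 1, z 2, z 3, z 4] * G 3 ![z 5, z 6, z 7, z 8, z 9]) p.domain → Set.EqOn q.integrand (fun z => F 3 ![z 0, z 1, z 2, z 3, z 4] * G 1 ![z 5, z 6, z 7, z 8, z 9]) q.domain → Set.EqOn s.integrand (fun z => F 1 ![z 0, z 1, z 2, z 3, z 4] * G 1 ![z 5, z 6, z 7, z 8, z 9]) s.domain → 225 • Literature.NumberTheory.Transcendental.KZ.of p + 225 • Literature.NumberTheory.Transcendental.KZ.of q - 104 • Literature.NumberTheory.Transcendental.KZ.of s ∈ Literature.NumberTheo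ry.Transcendental.KZ.relations

/-- item stmt-KontsevichZagierPeriods-6842 · crux · rank 6 · open · by planner
why it might fail: Stated nowhere in print (motivic shadow only, FresanJossen2020 Thm 5.1.1); complex Stokes chains between classical endpoints run through e^{−g−iθ}-weighted representations no known retraction sends back to KZ moves (e^{−c}, e^{−iθ} ∉ ℚ̄); granted soundness a witness refutes KZKernelConjecture.
sources: Literature.NumberTheory.Transcendental.KZexpC.comap_inclC_incl_le_iff, Literature.NumberTheory.Transcendental.KZexpC.comap_inclC_incl_le_of_kzKernelConjecture, Literature.NumberTheory.Transcendental.KZexpC.conservative_of_comap_inclC_incl_le, FresanJossen2020, KontsevichZagierPeriods2001, CommelinHabeggerHuber2020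
[crux] ComplexDescent (thesis conjunct X = KernelC ∧ ComplexDescent; needs definition KZexpC,
filed): in the COMPLEX-PHASE exponential calculus KZexpC (representations [σ, f, g, θ] with value
∫_σ e^{−g−iθ} f, f g θ ℚ-semialgebraic, e^{−g}|f| integrable; the five KZexp moves verbatim with
complex primitives Σ hᵢe^{−gᵢ−iθᵢ}), a ℤ-combination of CLASSICAL representations that is a KZexpC
relation is already a KZ relation: ∀ c : KZ.FormalRep, inclC (KZexp.incl c) ∈ KZexpC.relations → c ∈
KZ.relations. Implies KZexp.Conservative (0530) since inclC maps real relations to complex ones;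
with KernelC it implies the summit (same sandwich as KZexp.kzKernelConjecture_of_conservative).
Intended Lean once KZexpC lands: `∀ c : Literature.NumberTheory.Transcendental.KZ.FormalRep,
KZexpC.inclC (KZexp.incl c) ∈ KZexpC.relations → c ∈ KZ.relations`. WHY IT MIGHT FAIL: strictly
stronger than 0530 — Wick-wedge chains (this route's SumRuleSixC) give complex relations among
classical representations with no known classical shadow; a retraction must kill e^{−iθ} phases as
well as e^{−g} weights (cos 1, e^{−1} ∉ ℚ̄); false together with KZKernelConjecture only if some
Bessel relation is KZexpC-derivable bu -/
@[route_item "route-KontsevichZagierPeriods-WickWedge", crux]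
def ComplexDescent : Prop :=
  ∀ c : Literature.NumberTheory.Transcendental.KZ.FormalRep, Literature.NumberTheory.Transcendental.KZexpC.inclC (Literature.NumberTheory.Transcendental.KZexp.incl c) ∈ Literature.NumberTheory.Transcendental.KZexpC.relations → c ∈ Literature.NumberTheory.Transcendental.KZ.relations

/-- item stmt-KontsevichZagierPeriods-10546 · crux (kind.auto-crux: conjecture-grade) · rank 9 · open · by planner
why it might fail: GPC-strength exponential period conjecture in rules form for one specific move set: may fail for calculus-size reasons (no product/Fubini move, one-representation boundary terms) without contradicting KZ 2001 §4.3.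
sources: Literature.NumberTheory.Transcendental.KZexpC.ker_le_relations_iff, Literature.NumberTheory.Transcendental.KZexpC.kernelConjecture_of_comap_le_of_ker_le, KontsevichZagierPeriods2001, FresanJossen2020
[support] KernelC — the complex exponential kernel conjecture for the five moves of the
complex-phase calculus KZexpC (Literature/NumberTheory/Transcendental/KZExpCCalculus.lean): every
formal ℤ-combination of complex-phase exponential representations [σ, f, g, θ] with value 0 is a
consequence of the moves (elementwise form of KZexpC.eval.ker ≤ KZexpC.relations,
`KZexpC.ker_le_relations_iff`). Posed in KontsevichZagierPeriods2001 §4.3 ('Conjecture 1 of §1.2 can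
be extended in an appropriate way to the case of exponential periods'); GPC-strength (motivic
shadow: FresanJossen2020 Conj 8.2.6). Thesis conjunct X = KernelC ∧ ComplexDescent and hypothesis of
`closes`, but NOT staked on (support, as ExpKernelShadow 0293 was): the route's falsifiable content
is ComplexDescent + the Bessel corpus. Why it might fail: calculus size — no product/Fubini move,
one-representation boundary terms; the move set is this tree's reading of 'appropriate way'.
Replaces the dropped real shadow KZexp.KernelConjecture (real conservativity gives it back:
`KZexpC.kernelConjecture_of_comap_le_of_ker_le`). [difficulty: open-problem] -/
@[route_item "route-KontsevichZagierPeriods-WickWedge", crux]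
def KernelC : Prop :=
  ∀ c : Literature.NumberTheory.Transcendental.KZexpC.FormalRep, Literature.NumberTheory.Transcendental.KZexpC.eval c = 0 → c ∈ Literature.NumberTheory.Transcendental.KZexpC.relations

/-- item stmt-KontsevichZagierPeriods-5657 · crux · rank 9 · open · by planner
why it might fail: Classical evaluations integrate the fibres of A/S² to arctan/arccos primitives — outside rule 3 (barrier KZ.noSemialgebraicPrimitive_inv_sub_two); a chain keeping the angle as a coordinate needs a semialgebraic map onto the disc pair nobody has written; π² must appear from two rational fibres.
sources: BaileyEtAl2008, FresanSabbahYu2023, KontsevichZagierPeriods2001, Literature.Barriers.KontsevichZagierPeriods.KZ.noSemialgebraicPrimitive_inv_sub_two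
[support] k = 3 calibration (classical world): ∫₀^∞I₀K₀²t dt = π/(3√3) (sunrise at threshold: angle
π/3 of the equilateral triangle; BaileyEtAl2008), i.e. the rational 3-dimensional representation
R(1,2;1) (value π²/(3√3)) is KZ-equivalent to the constant √3/9 on a product of two unit discs; the
FSY k = 3 quadratic relation 27·R(1,2;1)² = π⁴ is its square. A prover who closes it records HOW the
arccos primitive is avoided (keep the angle as a dimension). [difficulty: L] -/
@[route_item "route-KontsevichZagierPeriods-WickWedge"]
def SunriseThreshold : Prop :=
  ∀ (r : Literature.NumberTheory.Transcendental.KZ.IntegralRep 3) (r' : Literature.NumberTheory.Transcendental.KZ.IntegralRep 4), r.domain = {x | 0 < x 0 ∧ 1 < x 1 ∧ 1 < x 2} → Set.EqOn r.integrand (fun x => (2 / (1 + x 0 ^ 2)) * (x 1)⁻¹ * (x 2)⁻¹ / ((x 1 + (x 1)⁻¹) / 2 + (x 2 + (x 2)⁻¹) / 2 - (1 - x 0 ^ 2) / (1 + x 0 ^ 2)) ^ 2) r.domain → r'.domain = {x | x 0 ^ 2 + x 1 ^ 2 < 1 ∧ x 2 ^ 2 + x 3 ^ 2 < 1} → Set.EqOn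 r'.integrand (fun _ => Real.sqrt 3 / 9) r'.domain → Literature.NumberTheory.Transcendental.KZ.Equivalent r r'

/-- item stmt-KontsevichZagierPeriods-5656 · support · rank 9 · open · by planner
sources: Literature.NumberTheory.Transcendental.KZexp.improperNewtonLeibnizRel, KontsevichZagierPeriods2001
[support] Schwinger/Laplace t-insertion is one improper Newton–Leibniz move (3b): if r.integrand =
c!·A/S^{c+1} on r.domain with A, S ℚ-semialgebraic there, C¹ on an open neighbourhood, S > 0, and e
is the representation on r.domain × [0,∞) (t last) with integrand A·tᶜ and weight t·S, then e ~ ofKZ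
r in KZexp (primitive −Σ_{m≤c}(c!/m!)tᵐS^{m−c−1}A·e^{−tS} → 0). Links SumRuleSix and SumRuleSixExp
(incl-image), calibrates (3b). [difficulty: M] -/
@[route_item "route-KontsevichZagierPeriods-WickWedge"]
def TInsertion : Prop :=
  ∀ (n c : ℕ) (r : Literature.NumberTheory.Transcendental.KZ.IntegralRep n) (e : Literature.NumberTheory.Transcendental.KZexp.IntegralRep (n + 1)) (A S : (Fin n → ℝ) → ℝ) (V : Set (Fin n → ℝ)), IsOpen V → r.domain ⊆ V → ContDiffOn ℝ 1 A V → ContDiffOn ℝ 1 S V → Literature.NumberTheory.Transcendental.IsSemialgebraicFunOn ℚ r.domain A → Literature.NumberTheory.Transcendental.IsSemialgebraicFunOn ℚ r.domain S → (∀ x ∈ r.domain, 0 < S x) → Set.EqOn r.integrand (fun x => (c.factorial : ℝ) * A x / S x ^ (c + 1)) r.domain → e.domain = {z | (Fin.init z : Fin n → ℝ) ∈ r.domain ∧ 0 ≤ z (Fin.last n)} → Set.EqOn e.integrand (fun z => A (Fin.init z : Fin n → ℝ) * z (Fin.last n) ^ c) e.domain → Set.EqOn e.weight (fun z => z (Fin.last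 n) * S (Fin.init z : Fin n → ℝ)) e.domain → Literature.NumberTheory.Transcendental.KZexp.Equivalent e (Literature.NumberTheory.Transcendental.KZexp.ofKZ r)

/-- item stmt-KontsevichZagierPeriods-5658 · support · rank 9 · closed · proved by Summit.KontsevichZagierPeriods.WickWedge.sumRuleSixKillSwitch_proof @ bdaa71ffd0ed (prover) · by planner
sources: Literature.NumberTheory.Transcendental.kzKernelConjecture_iff_isRational, FresanSabbahYu2023, Zhou2017
[support] with the value identity val R(3,3;1) = 3·val R(1,5;1) as hypothesis (FresanSabbahYu2023
Cor 7 / Zhou2017; cite-fact request filed), a proof that [R(3,3;1)] − 3[R(1,5;1)] is NOT a KZ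
relation refutes the summit (kernel form ⟺ summit, kzKernelConjecture_iff_isRational). Proved in the
folder Sketch.lean (5 lines). [difficulty: provable-now] -/
@[route_item "route-KontsevichZagierPeriods-WickWedge"]
def SumRuleSixKillSwitch : Prop :=
  ∀ (r₃ r₁ : Literature.NumberTheory.Transcendental.KZ.IntegralRep 6), r₃.domain = {x | 0 < x 0 ∧ 0 < x 1 ∧ 0 < x 2 ∧ 1 < x 3 ∧ 1 < x 4 ∧ 1 < x 5} → Set.EqOn r₃.integrand (fun x => (2 / (1 + x 0 ^ 2)) * (2 / (1 + x 1 ^ 2)) * (2 / (1 + x 2 ^ 2)) * (x 3)⁻¹ * (x 4)⁻¹ * (x 5)⁻¹ / ((x 3 + (x 3)⁻¹) / 2 + (x 4 + (x 4)⁻¹) / 2 + (x 5 + (x 5)⁻¹) / 2 - (1 - x 0 ^ 2) / (1 + x 0 ^ 2) - (1 - x 1 ^ 2) / (1 + x 1 ^ 2) - (1 - x 2 ^ 2) / (1 + x 2 ^ 2)) ^ 2) r₃.domain → r₁.domain = {x | 0 < x 0 ∧ 1 < x 1 ∧ 1 < x 2 ∧ 1 < x 3 ∧ 1 < x 4 ∧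 1 < x 5} → Set.EqOn r₁.integrand (fun x => (2 / (1 + x 0 ^ 2)) * (x 1)⁻¹ * (x 2)⁻¹ * (x 3)⁻¹ * (x 4)⁻¹ * (x 5)⁻¹ / ((x 1 + (x 1)⁻¹) / 2 + (x 2 + (x 2)⁻¹) / 2 + (x 3 + (x 3)⁻¹) / 2 + (x 4 + (x 4)⁻¹) / 2 + (x 5 + (x 5)⁻¹) / 2 - (1 - x 0 ^ 2) / (1 + x 0 ^ 2)) ^ 2) r₁.domain → r₃.value = 3 * r₁.value → Literature.NumberTheory.Transcendental.KZ.of r₃ - 3 • Literature.NumberTheory.Transcendental.KZ.of r₁ ∉ Literature.NumberTheory.Transcendental.KZ.relations → ¬ KontsevichZagierPeriods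

/-- item stmt-KontsevichZagierPeriods-6854 · support · rank 9 · open · by planner
[support] SumRuleSixC (engine demonstration; needs definition KZexpC): the k = 6 sum rule [E(3,3;1)]
− 3·[E(1,5;1)] (the Schwinger representations of crux SumRuleSixExp, pushed into KZexpC by inclC) IS
a KZexpC relation. Transcription of FresanSabbahYu2023 Cor 7 / Zhou2017 into moves: (a) monodromy
family — for α ∈ [0, π], K₀(te^{iα}) = −i∫₀^α e^{−te^{iα}cos φ}dφ + ∫₀^∞ e^{−t(cos²α·cosh v +
sin²α·sinh v) − i t sinα cosα e^{−v}} dv, every piece absolutely convergent with ℚ-semialgebraic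
data after c = cos φ, ξ = e^v (at α = π the pieces are −iπI₀(t) and K₀(t)); constancy in α is flat
transport = one bounded Newton–Leibniz move in α with the integrand as primitive plus Stokes in (c,
ξ); (b) Cauchy for G(t) = [K₀(t)K₀(te^{iπ})]³ t on the upper half-plane as two improper
Newton–Leibniz moves (∂_yG = i∂_xG, G → 0, |G| ~ |t|^{−2} so ∂G is integrable on the half-plane:
this is the range j < k/4 of Cor 7); (c) binomial expansion by integrand additivity, odd powers of
(−iπI₀) giving 3·[E(1,5;1)]·π⁻²-type terms — in the product representation the π² is carried by two
extra s-variables, matching E(3,3;1). Expected PROVABLE once KZexpC exists (long: ~10 moves,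
9-dimensional intermediates); fai -/
@[route_item "route-KontsevichZagierPeriods-WickWedge"]
def SumRuleSixC : Prop :=
  ∀ (e₃ e₁ : Literature.NumberTheory.Transcendental.KZexp.IntegralRep 7), e₃.domain = {z | 0 < z 0 ∧ 0 < z 1 ∧ 0 < z 2 ∧ 1 < z 3 ∧ 1 < z 4 ∧ 1 < z 5 ∧ 0 ≤ z 6} → Set.EqOn e₃.integrand (fun z => z 6 * ((2 / (1 + z 0 ^ 2)) * (2 / (1 + z 1 ^ 2)) * (2 / (1 + z 2 ^ 2)) * (z 3)⁻¹ * (z 4)⁻¹ * (z 5)⁻¹)) e₃.domain → Set.EqOn e₃.weight (fun z => z 6 * ((z 3 + (z 3)⁻¹) / 2 + (z 4 + (z 4)⁻¹) / 2 + (z 5 + (z 5)⁻¹) / 2 - (1 - z 0 ^ 2) / (1 + z 0 ^ 2) - (1 - z 1 ^ 2) / (1 + z 1 ^ 2) - (1 - z 2 ^ 2) / (1 + z 2 ^ 2))) e₃.domain → e₁.domain = {z | 0 < z 0 ∧ 1 < z 1 ∧ 1 < z 2 ∧ 1 < z 3 ∧ 1 < z 4 ∧ 1 < z 5 ∧ 0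 ≤ z 6} → Set.EqOn e₁.integrand (fun z => z 6 * ((2 / (1 + z 0 ^ 2)) * (z 1)⁻¹ * (z 2)⁻¹ * (z 3)⁻¹ * (z 4)⁻¹ * (z 5)⁻¹)) e₁.domain → Set.EqOn e₁.weight (fun z => z 6 * ((z 1 + (z 1)⁻¹) / 2 + (z 2 + (z 2)⁻¹) / 2 + (z 3 + (z 3)⁻¹) / 2 + (z 4 + (z 4)⁻¹) / 2 + (z 5 + (z 5)⁻¹) / 2 - (1 - z 0 ^ 2) / (1 + z 0 ^ 2))) e₁.domain → Literature.NumberTheory.Transcendental.KZexpC.inclC (Literature.NumberTheory.Transcendental.KZexp.of e₃ - 3 • Literature.NumberTheory.Transcendental.KZexp.of e₁) ∈ Literature.NumberTheory.Transcendental.KZexpC.relations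

-- earlier Assembly (stmt-KontsevichZagierPeriods-5659, replaced 2026-08-15T16:18:11Z -> stmt-KontsevichZagierPeriods-10545): retired by None — ExpConservativity → ExpKernelShadow → KontsevichZagierPeriods
/-- item stmt-KontsevichZagierPeriods-10545 · assembly · rank 1 · closed · proved by Summit.KontsevichZagierPeriods.WickWedge.assembly_proof @ 3c08c26bf6b9 (prover) · by planner
sources: Literature.NumberTheory.Transcendental.KZexp.kzKernelConjecture_of_conservative, Literature.NumberTheory.Transcendental.kzKernelConjecture_iff_isRational, KontsevichZagierPeriods2001
[assembly] ComplexDescent → KernelC → KontsevichZagierPeriods — PROVED (rev 3) as `theorem closes`: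
equal values ⇒ KZ.eval ([r] − [r′]) = 0 ⇒ inclC (incl ([r] − [r′])) has value 0
(`KZexpC.eval_inclC_incl`) ⇒ it is a KZexpC relation (KernelC) ⇒ [r] − [r′] ∈ KZ.relations
(ComplexDescent). -/
@[route_item "route-KontsevichZagierPeriods-WickWedge"]
def Assembly : Prop :=
  ComplexDescent → KernelC → KontsevichZagierPeriods

/-! D-0027 §2.1 — DECIDING THEOREM (planner-authored via `route open/edit --closes-file`; by planner-rbadge-KontsevichZagierPeriods-WickWed-26d3d325-g2-0 2026-08-15T16:18:11Z):
its hypotheses are this route's items and its conclusion the sub-problem Statement (glue_lint), and it elaborates with this file. -/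

@[closes "route-KontsevichZagierPeriods-WickWedge"] theorem closes (h₁ : ComplexDescent) (h₂ : KernelC) : KontsevichZagierPeriods := by
  intro n m r r' _ _ hv
  refine h₁ _ (h₂ _ ?_)
  rw [Literature.NumberTheory.Transcendental.KZexpC.eval_inclC_incl, map_sub,
    Literature.NumberTheory.Transcendental.KZ.eval_of, Literature.NumberTheory.Transcendental.KZ.eval_of, hv,
    sub_self, Complex.ofReal_zero]

end Summit.KontsevichZagierPeriods.KontsevichZagierPeriods.Theses.WickWedge
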